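import Mathlib.MeasureTheory.Integral.IntegralEqImproper
import Mathlib.MeasureTheory.Group.Prod
import Mathlib.Analysis.Normed.Group.Bounded
import Mathlib.Analysis.Calculus.Deriv.Shift
import Literature.NumberTheory.ConnesConsani2021.CosineTail
import Literature.NumberTheory.ConnesConsani2021.CosineTailPlancherel
import Literature.NumberTheory.ConnesConsani2021.CosineTailLogMoment
import Literature.NumberTheory.ConnesConsani2021.CosineTailDeltaSquare
import Literature.NumberTheory.ConnesConsani2021.CutoffScalingKernelEnergy
import Literature.NumberTheory.ConnesConsani2021.SchwartzKernels
import HarnessLib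

/-!
# Connes–Consani 2021, Prop. 2.2 (iii): the cosine-tail energy — FRAME and ASSEMBLY (RH-FREE)

A. Connes, C. Consani, *Weil positivity and trace formula, the archimedean place*, Selecta Math.
(N.S.) 27 (2021) 77 = arXiv:2006.13771 [bib: `ConnesConsani2021`], §1 (Lemma 1.4, Prop. 1.5) and §2
(Def. 2.1, Prop. 2.2 (i)–(iii)): "`Tr(ϑ(f) P P̂ P) = ∫ f(ρ⁻¹)(δ(ρ) − τ(ρ)) d*ρ`".  In the tree the named
fact `CC2021_prop_2_2_iii` (`SchwartzKernels.lean`) has been reduced by the cell (`CutoffScalingKernelTrace`,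
`CutoffScalingKernel`, `CutoffScalingKernelEnergy`: `CC2021_prop_2_2_iii_of_cosTail_energy`) to two
statements about ONE scalar object, the cosine-tail transform `cosTail g s c = ∫_{v ≥ s} g(v − c)
e^{v/2} cos(2π e^v) dv` of `CosineTail.lean`:

* (T1) `(s, c) ↦ ‖cosTail g s c‖²` is integrable on `[0, ∞) × ℝ`;
* (T2) `4 ∫_{[0,∞)×ℝ} ‖cosTail g s c‖² = Re L(g ∗ g*)`, `L = traceL = archW + remainderD`.

This file PROVES (T1) (`integrable_cosTail_normSq`), proves the FRAME of (T2) — an exact, finite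
identity (`cosTail_energy_frame`) expressing the energy `4∫∫‖cosTail‖²` as
`[∫ σ‖g(σ)‖² dσ + 4∫ c ‖cosTailFull g c‖² dc] + [4∫_{c ≤ a}(a − c)‖cosTailFull g c‖² dc −
4∫_{m ∈ [−a,a]} ∫_{c ≤ m} ‖cosTail g (c − m) c‖² dc dm]` (`supp g ⊆ [−a, a]`), i.e. as the sum of
the left-hand sides of the two analytic halves of the printed proof — the `W_∞`-half (Prop. 1.5 (iii):
the log-moment `4∫ c‖cosTailFull‖² = Re W_∞(g ∗ g*) − ∫σ‖g‖²`, Mellin side, `Γ′/Γ` through `θ′`) and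
the square-`Δ` half (Prop. 2.2 (i): the bracket equals `Re D(g ∗ g*)`), which are proved in the
companion files `CosineTailLogMoment.lean` (`cosTailFull_logMoment`) / `CosineTailDeltaSquare.lean`
(`cosTail_deltaSquare`) of the cell — assembles (T2) from them (`cosTail_energy_of_logMoment_of_deltaSquare`
with those two statements as hypotheses; `cosTail_energy` unconditionally), and DISCHARGES the named fact:
`CC2021_prop_2_2_iii_holds : CC2021_prop_2_2_iii`.

How the frame is obtained (all integrals absolutely convergent; no limit, no distribution):
1. one integration by parts `e^{v/2}cos(2πe^v) dv = e^{−v/2} d(sin 2πe^v)/2π` gives the uniform decay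
   `‖cosTail g s c‖ ≤ C_g e^{−s/2}` (`exists_norm_cosTail_le`), whence (T1) by a product dominator;
2. the shear `(s, c) ↦ (m, c) = (c − s, c)` (Lebesgue-measure preserving) turns `[0,∞) × ℝ` into
   `{c ≥ m}`; for `m < −a` the fiber vanishes, for `m ≥ a` the cut is invisible
   (`cosTail g (c − m) c = cosTailFull g c`) and Tonelli gives `4∫_{c ≥ a}(c − a)‖cosTailFull g c‖²`;
3. on the box `m ∈ [−a, a]` the fiber `∫_{c ≥ m}` is `∫_ℝ − ∫_{c < m}`, and `∫_ℝ‖cosTail g (c−m) c‖² dc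
   = ¼∫_{σ ≥ −m}‖g‖²` (Plancherel for the cosine transform, `L¹ ∩ L²` version of the tree) integrates
   over the box to `¼∫(a + σ)‖g(σ)‖²dσ`; with `4∫‖cosTailFull‖² = ∫‖g‖²` the `a‖g‖²` terms cancel.

Label: RH-FREE archimedean analysis (measure-theoretic frame of a Hilbert–Schmidt identity); bears_on
W-C/W-P (K1 boundary fact `CC2021_prop_2_2_iii`).  WHAT THIS IS NOT: any claim about `ζ` or RH —
nothing here bears on the truth of RH.  Theorems only (no definition, no named fact, no instance).

## References
* A. Connes, C. Consani, arXiv:2006.13771, §1 Lemma 1.4, Prop. 1.5 (arXiv items 7, 8) pp. 7–9;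
  §2 Def. 2.1, Prop. 2.2 (= arXiv Def. 9, Prop. 10) pp. 10–11. [ConnesConsani2021]
* E. C. Titchmarsh, *Introduction to the Theory of Fourier Integrals* (1948), Thm. 48 (Plancherel).
-/

noncomputable section

open _root_.MeasureTheory Complex Set Filter Real
open scoped Real Topology FourierTransform

namespace Literature.NumberTheory.ConnesConsani2021

open Literature.NumberTheory.LFunctions

variable {g : ℝ → ℂ} {a : ℝ}

/-! ## 0. Elementary facts about test functions -/

/-- A test function has its support in some symmetric interval `[−a, a]` with `a ≥ 0`. [folklore] -/
private theorem exists_tsupport_subset_Icc (hg : IsWeilTest g) :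
    ∃ a : ℝ, 0 ≤ a ∧ tsupport g ⊆ Set.Icc (-a) a := by
  obtain ⟨r, hr⟩ := hg.2.isCompact.isBounded.subset_closedBall (0 : ℝ)
  refine ⟨max r 0, le_max_right _ _, fun u hu => ?_⟩
  have h := hr hu
  rw [Metric.mem_closedBall, dist_zero_right, Real.norm_eq_abs] at h
  constructor
  · have := neg_abs_le u; have := le_max_left r 0; linarith
  · exact (le_abs_self u).trans (h.trans (le_max_left _ _))

/-- The derivative of a test function is continuous. [folklore] -/
private theorem continuous_deriv_of_isWeilTest (hg : IsWeilTest g) : Continuous (deriv g) :=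
  hg.1.continuous_deriv (by simp)

/-- A test function is differentiable. [folklore] -/
private theorem hasDerivAt_of_isWeilTest (hg : IsWeilTest g) (x : ℝ) : HasDerivAt g (deriv g x) x :=
  ((hg.1.differentiable (by simp)) x).hasDerivAt

/-! ## 1. One integration by parts: `‖cosTail g s c‖ ≤ C_g e^{−s/2}` -/

/-- **Uniform decay of the cosine tail in the cut variable.**  There is `C ≥ 0` (depending on `g` only)
with `‖cosTail g s c‖ ≤ C e^{−s/2}` for all real `s, c`: write `e^{v/2}cos(2πe^v) = (e^{−v/2}/2π)·
d/dv sin(2πe^v)` and integrate by parts on `(s, ∞)`; the boundary term is `g(s−c)e^{−s/2}sin(2πe^s)/2π`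
and the new integrand is `(g′ − g/2)(v−c) e^{−v/2} sin(2πe^v)/2π`, so `C = (sup‖g‖ + ∫‖g′ − g/2‖)/2π`
works.  (This is the step that tames the growing oscillatory kernel `k^u` of Lemma 1.4 (i); it replaces
the formal trace manipulations of the printed proof of Prop. 2.2 (iii).)
[cite: ConnesConsani2021, §1 Lemma 1.4 (i) (arXiv: Lemma 7 (i)) eq. (16) p. 7; §2 Prop. 2.2 (iii) proof p. 10 (chunk p0010:L59–L75)] -/
theorem exists_norm_cosTail_le (hg : IsWeilTest g) :
    ∃ C : ℝ, 0 ≤ C ∧ ∀ s c : ℝ, ‖cosTail g s c‖ ≤ C * Real.exp (-(s / 2)) := by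
  obtain ⟨a, ha0, hga⟩ := exists_tsupport_subset_Icc hg
  have hgc : Continuous g := hg.1.continuous
  obtain ⟨B, hB⟩ := hgc.bounded_above_of_compact_support hg.2
  have hB0 : 0 ≤ B := (norm_nonneg _).trans (hB 0)
  -- the function `g′ − g/2` and its `L¹` norm
  set h : ℝ → ℂ := fun u => deriv g u - (1 / 2 : ℂ) * g u with hh_def
  have hh_cont : Continuous h := (continuous_deriv_of_isWeilTest hg).sub (continuous_const.mul hgc)
  have hh_supp : HasCompactSupport h := hg.2.deriv.sub (hg.2.mul_left)
  have hh_int : Integrable h := hh_cont.integrable_of_hasCompactSupport hh_supp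
  set D : ℝ := ∫ u, ‖h u‖ with hD_def
  have hD0 : 0 ≤ D := integral_nonneg fun _ => norm_nonneg _
  refine ⟨(B + D) / (2 * π), by positivity, fun s c => ?_⟩
  -- the two factors of the integration by parts
  set G : ℝ → ℂ := fun v => g (v - c) * ((Real.exp (-v / 2) / (2 * π) : ℝ) : ℂ) with hG_def
  set G' : ℝ → ℂ := fun v => h (v - c) * ((Real.exp (-v / 2) / (2 * π) : ℝ) : ℂ) with hG'_def
  set Φ : ℝ → ℂ := fun v => ((Real.sin (2 * π * Real.exp v) : ℝ) : ℂ) with hΦ_def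
  set Φ' : ℝ → ℂ := fun v => ((2 * π * Real.exp v * Real.cos (2 * π * Real.exp v) : ℝ) : ℂ)
    with hΦ'_def
  -- derivative of `G`
  have hG : ∀ v, HasDerivAt G (G' v) v := by
    intro v
    have h1 : HasDerivAt (fun v : ℝ => g (v - c)) (deriv g (v - c)) v :=
      HasDerivAt.comp_sub_const v c (hasDerivAt_of_isWeilTest hg (v - c))
    have h2 : HasDerivAt (fun x : ℝ => Real.exp (-x / 2) / (2 * π))
        (Real.exp (-v / 2) * (-1 / 2) / (2 * π)) v :=
      ((hasDerivAt_neg' (x := v)).div_const 2).exp.div_const (2 * π)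
    have h12 := h1.mul h2.ofReal_comp
    have hfun : G = (fun v : ℝ => g (v - c)) * fun y : ℝ => ((Real.exp (-y / 2) / (2 * π) : ℝ) : ℂ) := by
      funext y; simp [hG_def]
    rw [hfun]
    refine h12.congr_deriv ?_
    simp only [hG'_def, hh_def]
    push_cast
    ring
  -- derivative of `Φ`
  have hΦ : ∀ v, HasDerivAt Φ (Φ' v) v := by
    intro v
    have h1 : HasDerivAt (fun v : ℝ => Real.sin (2 * π * Real.exp v))
        (Real.cos (2 * π * Real.exp v) * (2 * π * Real.exp v)) v :=
      (Real.hasDerivAt_sin _).comp v ((Real.hasDerivAt_exp v).const_mul (2 * π))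
    refine (h1.ofReal_comp).congr_deriv ?_
    simp only [hΦ'_def]
    push_cast
    ring
  -- the IBP integrand is the `cosTail` integrand
  have hGΦ' : ∀ v, G v * Φ' v = g (v - c) * (cosTailKernel v : ℂ) := by
    intro v
    simp only [hG_def, hΦ'_def, cosTailKernel]
    rw [mul_assoc, ← Complex.ofReal_mul]
    refine congrArg (fun r : ℝ => g (v - c) * (r : ℂ)) ?_
    have he : Real.exp (-v / 2) * Real.exp v = Real.exp (v / 2) := by
      rw [← Real.exp_add]; congr 1; ring
    have hπ : (2 : ℝ) * π ≠ 0 := by positivity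
    calc Real.exp (-v / 2) / (2 * π) * (2 * π * Real.exp v * Real.cos (2 * π * Real.exp v))
        = (Real.exp (-v / 2) * Real.exp v) * Real.cos (2 * π * Real.exp v) *
            ((2 * π) / (2 * π)) := by ring
      _ = Real.exp (v / 2) * Real.cos (2 * π * Real.exp v) := by
          rw [he, div_self hπ, mul_one]
  -- support facts: `G` and `G'` vanish for `v > c + a`
  have hG_zero : ∀ v, c + a < v → G v = 0 := by
    intro v hv
    have : g (v - c) = 0 := image_eq_zero_of_notMem_tsupport fun hm => by
      have := (hga hm).2; linarith
    simp [hG_def, this]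
  -- continuity
  have hE_cont : Continuous fun v : ℝ => ((Real.exp (-v / 2) / (2 * π) : ℝ) : ℂ) :=
    Complex.continuous_ofReal.comp ((Real.continuous_exp.comp (continuous_neg.div_const 2)).div_const _)
  have hG_cont : Continuous G := (hgc.comp (continuous_id.sub continuous_const)).mul hE_cont
  have hG'_cont : Continuous G' := (hh_cont.comp (continuous_id.sub continuous_const)).mul hE_cont
  have hΦ_cont : Continuous Φ := Complex.continuous_ofReal.comp
    ((Real.continuous_sin.comp (continuous_const.mul Real.continuous_exp)))
  have hΦ'_cont : Continuous Φ' := Complex.continuous_ofReal.comp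
    (((continuous_const.mul Real.continuous_exp)).mul
      (Real.continuous_cos.comp (continuous_const.mul Real.continuous_exp)))
  have hΦ_bdd : ∀ v, ‖Φ v‖ ≤ 1 := fun v => by
    simp only [hΦ_def, Complex.norm_real, Real.norm_eq_abs]
    exact Real.abs_sin_le_one _
  -- compact support of `G`, `G'`
  have hG_supp : HasCompactSupport G :=
    ((hg.2.comp_homeomorph (Homeomorph.subRight c))).mul_right
  have hG'_supp : HasCompactSupport G' :=
    ((hh_supp.comp_homeomorph (Homeomorph.subRight c))).mul_right
  -- integrability of `G Φ'` and `G' Φ`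
  have hGΦ'_int : Integrable (fun v => G v * Φ' v) :=
    (hG_cont.mul hΦ'_cont).integrable_of_hasCompactSupport hG_supp.mul_right
  have hG'Φ_int : Integrable (fun v => G' v * Φ v) :=
    (hG'_cont.mul hΦ_cont).integrable_of_hasCompactSupport hG'_supp.mul_right
  -- limits at the endpoints
  have h_zero : Tendsto (G * Φ) (𝓝[>] s) (𝓝 (G s * Φ s)) :=
    ((hG_cont.mul hΦ_cont).tendsto s).mono_left nhdsWithin_le_nhds
  have h_infty : Tendsto (G * Φ) atTop (𝓝 0) := by
    apply tendsto_const_nhds.congr'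
    filter_upwards [eventually_gt_atTop (c + a)] with v hv
    simp [hG_zero v hv]
  -- integration by parts on `(s, ∞)`
  have hIBP := integral_Ioi_mul_deriv_eq_deriv_mul (a := s) (fun v _ => hG v) (fun v _ => hΦ v)
    hGΦ'_int.integrableOn hG'Φ_int.integrableOn h_zero h_infty
  have hct : cosTail g s c = 0 - G s * Φ s - ∫ v in Ioi s, G' v * Φ v := by
    rw [cosTail_eq, integral_Ici_eq_integral_Ioi, ← hIBP]
    exact setIntegral_congr_fun measurableSet_Ioi fun v _ => (hGΦ' v).symm
  -- estimate
  have hexp : ∀ v, s < v → Real.exp (-v / 2) ≤ Real.exp (-s / 2) := fun v hv =>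
    Real.exp_le_exp.2 (by linarith)
  have hes : Real.exp (-s / 2) = Real.exp (-(s / 2)) := by rw [neg_div]
  have hGs : ‖G s * Φ s‖ ≤ B / (2 * π) * Real.exp (-(s / 2)) := by
    rw [norm_mul]
    calc ‖G s‖ * ‖Φ s‖ ≤ ‖G s‖ * 1 := mul_le_mul_of_nonneg_left (hΦ_bdd s) (norm_nonneg _)
      _ = ‖g (s - c)‖ * (Real.exp (-s / 2) / (2 * π)) := by
          rw [mul_one, hG_def, norm_mul, Complex.norm_real, Real.norm_eq_abs,
            abs_of_nonneg (by positivity)]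
      _ ≤ B * (Real.exp (-s / 2) / (2 * π)) :=
          mul_le_mul_of_nonneg_right (hB _) (by positivity)
      _ = B / (2 * π) * Real.exp (-(s / 2)) := by rw [hes]; ring
  have hint : ‖∫ v in Ioi s, G' v * Φ v‖ ≤ D / (2 * π) * Real.exp (-(s / 2)) := by
    have hbd : ∀ v ∈ Ioi s, ‖G' v * Φ v‖ ≤ Real.exp (-(s / 2)) / (2 * π) * ‖h (v - c)‖ := by
      intro v hv
      rw [norm_mul, ← hes]
      calc ‖G' v‖ * ‖Φ v‖ ≤ ‖G' v‖ * 1 := mul_le_mul_of_nonneg_left (hΦ_bdd v) (norm_nonneg _)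
        _ = ‖h (v - c)‖ * (Real.exp (-v / 2) / (2 * π)) := by
            rw [mul_one, hG'_def, norm_mul, Complex.norm_real, Real.norm_eq_abs,
              abs_of_nonneg (by positivity)]
        _ ≤ ‖h (v - c)‖ * (Real.exp (-s / 2) / (2 * π)) :=
            mul_le_mul_of_nonneg_left (div_le_div_of_nonneg_right (hexp v hv) (by positivity))
              (norm_nonneg _)
        _ = Real.exp (-s / 2) / (2 * π) * ‖h (v - c)‖ := by ring
    have hhi : Integrable (fun v => Real.exp (-(s / 2)) / (2 * π) * ‖h (v - c)‖) :=
      ((hh_int.comp_sub_right c).norm.const_mul _)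
    calc ‖∫ v in Ioi s, G' v * Φ v‖ ≤ ∫ v in Ioi s, ‖G' v * Φ v‖ := norm_integral_le_integral_norm _
      _ ≤ ∫ v in Ioi s, Real.exp (-(s / 2)) / (2 * π) * ‖h (v - c)‖ :=
          setIntegral_mono_on hG'Φ_int.norm.integrableOn hhi.integrableOn measurableSet_Ioi hbd
      _ ≤ ∫ v, Real.exp (-(s / 2)) / (2 * π) * ‖h (v - c)‖ :=
          setIntegral_le_integral hhi (Eventually.of_forall fun v => by positivity)
      _ = Real.exp (-(s / 2)) / (2 * π) * ∫ v, ‖h (v - c)‖ := integral_const_mul _ _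
      _ = Real.exp (-(s / 2)) / (2 * π) * D := by
          rw [hD_def]; congr 1
          exact integral_sub_right_eq_self (fun u => ‖h u‖) c
      _ = D / (2 * π) * Real.exp (-(s / 2)) := by ring
  calc ‖cosTail g s c‖ = ‖-(G s * Φ s) - ∫ v in Ioi s, G' v * Φ v‖ := by rw [hct, zero_sub]
    _ ≤ ‖-(G s * Φ s)‖ + ‖∫ v in Ioi s, G' v * Φ v‖ := norm_sub_le _ _
    _ ≤ B / (2 * π) * Real.exp (-(s / 2)) + D / (2 * π) * Real.exp (-(s / 2)) := by
        rw [norm_neg]; exact add_le_add hGs hint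
    _ = (B + D) / (2 * π) * Real.exp (-(s / 2)) := by ring


/-- **Decay in the other variable.**  If `supp g ⊆ [−a, a]` and `‖cosTail g s c‖ ≤ C e^{−s/2}` for all
`s, c` (previous lemma), then also `‖cosTail g s c‖ ≤ C e^{a/2} e^{−c/2}` for all `s, c`: for `c + a < s`
the tail vanishes (`cosTail_eq_zero`); for `s ≤ c − a` the cut is invisible, `cosTail g s c = cosTailFull g c
= cosTail g (c − a) c` (`cosTail_eq_cosTailFull`), and the first bound at `s = c − a` applies; in between
`e^{−s/2} ≤ e^{a/2}e^{−c/2}`. [cite: ConnesConsani2021, §1 eq. (16)–(17) p. 7; §2 Prop. 2.2 (iii) proof p. 10 (chunk p0010:L59–L75)] -/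
theorem norm_cosTail_le_exp_neg_half (hga : tsupport g ⊆ Set.Icc (-a) a) {C : ℝ} (hC0 : 0 ≤ C)
    (hC : ∀ s c : ℝ, ‖cosTail g s c‖ ≤ C * Real.exp (-(s / 2))) (s c : ℝ) :
    ‖cosTail g s c‖ ≤ C * Real.exp (a / 2) * Real.exp (-(c / 2)) := by
  have hRHS : C * Real.exp (a / 2) * Real.exp (-(c / 2)) = C * Real.exp (-((c - a) / 2)) := by
    rw [mul_assoc, ← Real.exp_add]; congr 1; congr 1; ring
  rcases lt_or_ge (c + a) s with h1 | h1
  · rw [cosTail_eq_zero hga h1, norm_zero]; positivity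
  rcases le_or_gt s (c - a) with h2 | h2
  · -- below the support: `cosTail g s c = cosTailFull g c = cosTail g (c - a) c`
    rw [cosTail_eq_cosTailFull hga h2, ← cosTail_eq_cosTailFull hga (le_refl (c - a)), hRHS]
    exact hC (c - a) c
  · -- `c - a < s ≤ c + a`
    rw [hRHS]
    refine (hC s c).trans (mul_le_mul_of_nonneg_left (Real.exp_le_exp.2 (by linarith)) hC0)

/-! ## 2. (T1): square-integrability of `cosTail g` on `[0, ∞) × ℝ` -/

/-- **(T1) The cosine-tail energy is finite**: `(s, c) ↦ ‖cosTail g s c‖²` is integrable on `[0,∞) × ℝ`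
(the Hilbert–Schmidt property of `P𝓕Pϑ(g)E`, i.e. the finiteness of `Tr(ϑ(g g*)PP̂P)` in Prop. 2.2 (iii)).
Proof: by the two decay bounds, for `s ≥ 0` one has `‖cosTail g s c‖² ≤ C²e^{a/2}·e^{−s/2}·e^{−c/2}1_{c ≥ −a}`
(the tail vanishes for `c < −a ≤ s − a`), a product of two integrable functions.
[cite: ConnesConsani2021, §2 Prop. 2.2 (iii) (= arXiv Prop. 10 (iii)) p. 10 (chunk p0010:L20, L59–L75)] -/
theorem integrable_cosTail_normSq (hg : IsWeilTest g) :
    Integrable (fun p : ℝ × ℝ => ‖cosTail g p.1 p.2‖ ^ 2)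
      (((volume : Measure ℝ).restrict (Set.Ici 0)).prod (volume : Measure ℝ)) := by
  obtain ⟨a, ha0, hga⟩ := exists_tsupport_subset_Icc hg
  obtain ⟨C, hC0, hC⟩ := exists_norm_cosTail_le hg
  have hC' := norm_cosTail_le_exp_neg_half hga hC0 hC
  -- the dominator
  set f₁ : ℝ → ℝ := fun s => C ^ 2 * Real.exp (a / 2) * Real.exp (-(1 / 2) * s) with hf₁
  set f₂ : ℝ → ℝ := fun c => (Set.Ici (-a)).indicator (fun c => Real.exp (-(1 / 2) * c)) c with hf₂
  have hf₁i : Integrable f₁ ((volume : Measure ℝ).restrict (Set.Ici 0)) := by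
    have h := (exp_neg_integrableOn_Ioi 0 (by norm_num : (0 : ℝ) < 1 / 2))
    have h' : IntegrableOn (fun s : ℝ => Real.exp (-(1 / 2) * s)) (Set.Ici 0) := by
      rw [integrableOn_Ici_iff_integrableOn_Ioi]; exact h
    exact h'.const_mul _
  have hf₂i : Integrable f₂ (volume : Measure ℝ) := by
    rw [hf₂, integrable_indicator_iff measurableSet_Ici]
    rw [integrableOn_Ici_iff_integrableOn_Ioi]
    exact exp_neg_integrableOn_Ioi (-a) (by norm_num)
  have hdom : Integrable (fun p : ℝ × ℝ => f₁ p.1 * f₂ p.2)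
      (((volume : Measure ℝ).restrict (Set.Ici 0)).prod (volume : Measure ℝ)) := hf₁i.mul_prod hf₂i
  -- measurability
  have hmeas : AEStronglyMeasurable (fun p : ℝ × ℝ => ‖cosTail g p.1 p.2‖ ^ 2)
      (((volume : Measure ℝ).restrict (Set.Ici 0)).prod (volume : Measure ℝ)) := by
    have hm := measurable_cosTail hg.1.continuous hg.2
    exact ((continuous_pow 2).measurable.comp (continuous_norm.measurable.comp hm)).aestronglyMeasurable
  -- a.e. `s ≥ 0`
  have hae : ∀ᵐ p : ℝ × ℝ ∂(((volume : Measure ℝ).restrict (Set.Ici 0)).prod (volume : Measure ℝ)),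
      p.1 ∈ Set.Ici (0 : ℝ) :=
    (Measure.quasiMeasurePreserving_fst (μ := (volume : Measure ℝ).restrict (Set.Ici 0))
      (ν := (volume : Measure ℝ))).ae (ae_restrict_mem measurableSet_Ici)
  refine hdom.mono' hmeas ?_
  filter_upwards [hae] with p hp
  obtain ⟨s, c⟩ := p
  simp only [Set.mem_Ici] at hp
  rw [Real.norm_eq_abs, abs_of_nonneg (by positivity)]
  change ‖cosTail g s c‖ ^ 2 ≤ f₁ s * f₂ c
  by_cases hc : c ∈ Set.Ici (-a)
  · rw [hf₂]; simp only [Set.indicator_of_mem hc, hf₁]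
    have h1 := hC s c
    have h2 := hC' s c
    have e1 : Real.exp (-(s / 2)) = Real.exp (-(1 / 2) * s) := by congr 1; ring
    have e2 : Real.exp (-(c / 2)) = Real.exp (-(1 / 2) * c) := by congr 1; ring
    rw [e1] at h1; rw [e2] at h2
    calc ‖cosTail g s c‖ ^ 2 = ‖cosTail g s c‖ * ‖cosTail g s c‖ := sq _
      _ ≤ (C * Real.exp (-(1 / 2) * s)) * (C * Real.exp (a / 2) * Real.exp (-(1 / 2) * c)) :=
          mul_le_mul h1 h2 (norm_nonneg _) (by positivity)
      _ = C ^ 2 * Real.exp (a / 2) * Real.exp (-(1 / 2) * s) * Real.exp (-(1 / 2) * c) := by ring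
  · -- `c < -a ≤ s - a`: the tail vanishes
    have hc' : c + a < s := by simp only [Set.mem_Ici, not_le] at hc; linarith
    rw [cosTail_eq_zero hga hc', norm_zero, hf₂]
    simp [Set.indicator_of_notMem hc]


/-! ## 3. The shear `(s, c) ↦ (m, c) = (c − s, c)`: the energy as an integral over cut-off fibers -/

/-- The shear `(m, c) ↦ (c − m, c)` preserves Lebesgue measure on `ℝ × ℝ` (it is the composition of
Mathlib's `(x, y) ↦ (x − y, y)` with the reflection of the first coordinate). [folklore] -/
private theorem measurePreserving_cosTailShear :
    MeasurePreserving (fun p : ℝ × ℝ => (p.2 - p.1, p.2))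
      ((volume : Measure ℝ).prod volume) ((volume : Measure ℝ).prod volume) := by
  have h1 := measurePreserving_sub_prod (volume : Measure ℝ) (volume : Measure ℝ)
  have h2 := (Measure.measurePreserving_neg (volume : Measure ℝ)).prod
    (MeasurePreserving.id (volume : Measure ℝ))
  have h := h2.comp h1
  refine ⟨(measurable_snd.sub measurable_fst).prodMk measurable_snd, ?_⟩
  convert h.map_eq using 2
  funext p
  simp [Prod.map, neg_sub]

/-- **The energy over cut-off fibers.**  After the Lebesgue-measure-preserving shear `(s, c) ↦ (m, c)`,
`m := c − s` ("the cut index in the frame of `g`"), the energy `∫_{s ≥ 0}∫_ℝ ‖cosTail g s c‖²` becomes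
`∫_ℝ (∫_{c ≥ m} ‖cosTail g (c − m) c‖² dc) dm`, and the sheared integrand is integrable on `ℝ × ℝ`.
[cite: ConnesConsani2021, §2 Prop. 2.2 (iii) (= arXiv Prop. 10 (iii)) p. 10 (chunk p0010:L20, L59–L75)] -/
theorem cosTail_energy_eq_integral_fiber (hg : IsWeilTest g) :
    Integrable (fun q : ℝ × ℝ => ({q : ℝ × ℝ | q.1 ≤ q.2}).indicator
        (fun q => ‖cosTail g (q.2 - q.1) q.2‖ ^ 2) q) ((volume : Measure ℝ).prod volume) ∧
    ∫ p, ‖cosTail g p.1 p.2‖ ^ 2 ∂(((volume : Measure ℝ).restrict (Set.Ici 0)).prod (volume : Measure ℝ))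
      = ∫ m : ℝ, ∫ c in Set.Ici m, ‖cosTail g (c - m) c‖ ^ 2 := by
  set N : ℝ × ℝ → ℝ := fun p => ‖cosTail g p.1 p.2‖ ^ 2 with hN
  set G : ℝ × ℝ → ℝ := (Set.Ici (0 : ℝ) ×ˢ (Set.univ : Set ℝ)).indicator N with hG
  set Ψ : ℝ × ℝ → ℝ := fun q => ({q : ℝ × ℝ | q.1 ≤ q.2}).indicator
    (fun q => ‖cosTail g (q.2 - q.1) q.2‖ ^ 2) q with hΨ
  have hS : MeasurableSet (Set.Ici (0 : ℝ) ×ˢ (Set.univ : Set ℝ)) :=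
    measurableSet_Ici.prod MeasurableSet.univ
  have hμ : ((volume : Measure ℝ).restrict (Set.Ici 0)).prod (volume : Measure ℝ)
      = ((volume : Measure ℝ).prod volume).restrict (Set.Ici 0 ×ˢ Set.univ) := by
    rw [← Measure.prod_restrict, Measure.restrict_univ]
  -- the shear `φ (m, c) = (c − m, c)` and `G ∘ φ = Ψ`
  set φ : ℝ × ℝ → ℝ × ℝ := fun p => (p.2 - p.1, p.2) with hφ_def
  have hφm : Measurable φ := (measurable_snd.sub measurable_fst).prodMk measurable_snd
  have hφ : MeasurePreserving φ ((volume : Measure ℝ).prod volume) ((volume : Measure ℝ).prod volume) :=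
    measurePreserving_cosTailShear
  have hGΨ : ∀ q, G (φ q) = Ψ q := by
    intro q
    simp only [hG, hΨ, hφ_def, Set.indicator, Set.mem_prod, Set.mem_Ici, Set.mem_univ,
      and_true, Set.mem_setOf_eq, sub_nonneg, hN]
  -- integrability of `G` from (T1)
  have hT1 := integrable_cosTail_normSq hg
  have hGi : Integrable G ((volume : Measure ℝ).prod volume) := by
    rw [hG, integrable_indicator_iff hS, IntegrableOn, ← hμ]
    exact hT1
  have hΨi : Integrable Ψ ((volume : Measure ℝ).prod volume) := by
    have h := (hφ.integrable_comp hGi.aestronglyMeasurable).2 hGi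
    exact h.congr (Eventually.of_forall fun q => hGΨ q)
  refine ⟨hΨi, ?_⟩
  -- the energy as `∫ G`, then `∫ Ψ`, then Fubini
  have h1 : ∫ p, N p ∂(((volume : Measure ℝ).restrict (Set.Ici 0)).prod (volume : Measure ℝ))
      = ∫ p, G p ∂((volume : Measure ℝ).prod volume) := by
    rw [hμ, hG, integral_indicator hS]
  have h2 : ∫ p, G p ∂((volume : Measure ℝ).prod volume) = ∫ q, Ψ q ∂((volume : Measure ℝ).prod volume) := by
    have h := integral_map (μ := (volume : Measure ℝ).prod volume) hφm.aemeasurable (f := G)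
      (by rw [hφ.map_eq]; exact hGi.aestronglyMeasurable)
    rw [hφ.map_eq] at h
    rw [h]
    exact integral_congr_ae (Eventually.of_forall fun q => hGΨ q)
  have h3 : ∫ q, Ψ q ∂((volume : Measure ℝ).prod volume) = ∫ m : ℝ, ∫ c : ℝ, Ψ (m, c) :=
    integral_prod Ψ hΨi
  have h4 : ∀ m : ℝ, ∫ c : ℝ, Ψ (m, c) = ∫ c in Set.Ici m, ‖cosTail g (c - m) c‖ ^ 2 := by
    intro m
    rw [← integral_indicator measurableSet_Ici]
    congr 1 with c
  change ∫ p, N p ∂_ = _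
  rw [h1, h2, h3]
  exact integral_congr_ae (Eventually.of_forall fun m => h4 m)

/-- The fiber energy `m ↦ ∫_{c ≥ m} ‖cosTail g (c − m) c‖² dc` is integrable over `ℝ`. [cite: ConnesConsani2021, §2 Prop. 2.2 (iii) (= arXiv Prop. 10 (iii)) p. 10 (chunk p0010:L20)] -/
theorem integrable_fiber_energy (hg : IsWeilTest g) :
    Integrable (fun m : ℝ => ∫ c in Set.Ici m, ‖cosTail g (c - m) c‖ ^ 2) := by
  have h := (cosTail_energy_eq_integral_fiber hg).1.integral_prod_left
  refine h.congr (Eventually.of_forall fun m => ?_)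
  simp only
  rw [← integral_indicator measurableSet_Ici]
  congr 1 with c


/-! ## 4. The fibers: empty below the support, uncut above it -/

/-- For `m < −a` the fiber is empty: `cosTail g (c − m) c = 0` for every `c` (the cut `c − m > c + a` lies
above the support). [cite: ConnesConsani2021, §1 eq. (17) p. 7] -/
theorem fiber_eq_zero (hga : tsupport g ⊆ Set.Icc (-a) a) {m : ℝ} (hm : m < -a) :
    ∫ c in Set.Ici m, ‖cosTail g (c - m) c‖ ^ 2 = 0 := by
  refine setIntegral_eq_zero_of_forall_eq_zero fun c _ => ?_
  rw [cosTail_eq_zero hga (by linarith), norm_zero]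
  simp

/-- For `m ≥ a` the cut is invisible on the fiber: `cosTail g (c − m) c = cosTailFull g c` for every `c`.
[cite: ConnesConsani2021, §1 eq. (17) p. 7] -/
theorem cosTail_sub_eq_cosTailFull (hga : tsupport g ⊆ Set.Icc (-a) a) {m : ℝ} (hm : a ≤ m) (c : ℝ) :
    cosTail g (c - m) c = cosTailFull g c :=
  cosTail_eq_cosTailFull hga (by linarith)

/-! ## 5. Two-sided decay of the full transform and weighted integrability -/

/-- `‖cosTailFull g c‖² ≤ K e^{−|c|}`: for `c ≥ 0` from the integration by parts (`cosTailFull g c =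
cosTail g (c − a) c`), for `c ≤ 0` from the trivial bound `‖cosTailFull g c‖ ≤ e^{(c+a)/2}∫‖g‖`.
[cite: ConnesConsani2021, §1 Lemma 1.4 (i) eq. (16) p. 7] -/
theorem exists_norm_sq_cosTailFull_le (hg : IsWeilTest g) (hga : tsupport g ⊆ Set.Icc (-a) a) :
    ∃ K : ℝ, 0 ≤ K ∧ ∀ c : ℝ, ‖cosTailFull g c‖ ^ 2 ≤ K * Real.exp (-|c|) := by
  obtain ⟨C, hC0, hC⟩ := exists_norm_cosTail_le hg
  have hC' := norm_cosTail_le_exp_neg_half hga hC0 hC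
  set L : ℝ := ∫ u, ‖g u‖ with hL
  have hL0 : 0 ≤ L := integral_nonneg fun _ => norm_nonneg _
  refine ⟨Real.exp a * (C ^ 2 + L ^ 2), by positivity, fun c => ?_⟩
  rcases le_or_gt 0 c with hc | hc
  · -- `c ≥ 0`: `cosTailFull g c = cosTail g (c - a) c`
    have h1 : ‖cosTailFull g c‖ ≤ C * Real.exp (a / 2) * Real.exp (-(c / 2)) := by
      rw [← cosTail_eq_cosTailFull hga (le_refl (c - a))]
      exact hC' (c - a) c
    have h0 : 0 ≤ C * Real.exp (a / 2) * Real.exp (-(c / 2)) := by positivity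
    calc ‖cosTailFull g c‖ ^ 2 ≤ (C * Real.exp (a / 2) * Real.exp (-(c / 2))) ^ 2 :=
          pow_le_pow_left₀ (norm_nonneg _) h1 2
      _ = Real.exp a * C ^ 2 * Real.exp (-|c|) := by
          rw [abs_of_nonneg hc, mul_pow, mul_pow, ← Real.exp_nat_mul, ← Real.exp_nat_mul]
          push_cast; ring_nf
      _ ≤ Real.exp a * (C ^ 2 + L ^ 2) * Real.exp (-|c|) := by
          gcongr; nlinarith
  · -- `c < 0`: trivial bound
    have h1 : ‖cosTailFull g c‖ ≤ Real.exp ((c + a) / 2) * L :=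
      norm_cosTailFull_le hg.1.continuous hg.2 hga c
    have h0 : 0 ≤ Real.exp ((c + a) / 2) * L := by positivity
    calc ‖cosTailFull g c‖ ^ 2 ≤ (Real.exp ((c + a) / 2) * L) ^ 2 :=
          pow_le_pow_left₀ (norm_nonneg _) h1 2
      _ = Real.exp a * L ^ 2 * Real.exp (-|c|) := by
          rw [abs_of_neg hc, mul_pow, ← Real.exp_nat_mul, neg_neg]
          rw [show ((2 : ℕ) : ℝ) * ((c + a) / 2) = a + c by push_cast; ring, Real.exp_add]
          ring
      _ ≤ Real.exp a * (C ^ 2 + L ^ 2) * Real.exp (-|c|) := by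
          gcongr; nlinarith

/-- `t ↦ e^{−b|t|}` is integrable on `ℝ` for `b > 0`. [folklore] -/
private theorem integrable_exp_neg_mul_abs' {b : ℝ} (hb : 0 < b) :
    Integrable fun t : ℝ => Real.exp (-b * |t|) := by
  have hIoi : IntegrableOn (fun t : ℝ => Real.exp (-b * |t|)) (Ioi 0) := by
    refine (exp_neg_integrableOn_Ioi 0 hb).congr_fun (fun t ht => ?_) measurableSet_Ioi
    rw [abs_of_pos (mem_Ioi.1 ht)]
  have hIic : IntegrableOn (fun t : ℝ => Real.exp (-b * |t|)) (Iic 0) := by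
    rw [← Measure.map_neg_eq_self (volume : Measure ℝ)]
    let m : MeasurableEmbedding fun x : ℝ => -x := (Homeomorph.neg ℝ).measurableEmbedding
    rw [m.integrableOn_map_iff]
    simp_rw [Function.comp_def, abs_neg, neg_preimage, neg_Iic, neg_zero]
    exact Iff.mpr integrableOn_Ici_iff_integrableOn_Ioi hIoi
  have := hIic.union hIoi
  rwa [Iic_union_Ioi, integrableOn_univ] at this

/-- `(1 + |c|)·‖cosTailFull g c‖²` is integrable (two-sided exponential decay). [cite: ConnesConsani2021, §1 Lemma 1.4 (i) eq. (16) p. 7] -/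
theorem integrable_one_add_abs_mul_norm_sq_cosTailFull (hg : IsWeilTest g)
    (hga : tsupport g ⊆ Set.Icc (-a) a) :
    Integrable fun c : ℝ => (1 + |c|) * ‖cosTailFull g c‖ ^ 2 := by
  obtain ⟨K, hK0, hK⟩ := exists_norm_sq_cosTailFull_le hg hga
  have hcont : Continuous fun c : ℝ => (1 + |c|) * ‖cosTailFull g c‖ ^ 2 :=
    (continuous_const.add continuous_abs).mul ((continuous_cosTailFull hg.1.continuous hg.2).norm.pow 2)
  refine ((integrable_exp_neg_mul_abs' (by norm_num : (0 : ℝ) < 1 / 2)).const_mul (3 * K)).mono'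
    hcont.aestronglyMeasurable (Eventually.of_forall fun c => ?_)
  rw [Real.norm_eq_abs, abs_of_nonneg (by positivity)]
  -- `(1 + |c|) e^{-|c|} ≤ 3 e^{-|c|/2}`
  have h1 : |c| * Real.exp (-(|c| / 2)) ≤ 2 := by
    have h := Real.add_one_le_exp (|c| / 2)
    have hpos := Real.exp_pos (-(|c| / 2))
    have : Real.exp (|c| / 2) * Real.exp (-(|c| / 2)) = 1 := by
      rw [← Real.exp_add]; simp
    nlinarith [abs_nonneg c]
  have h2 : (1 + |c|) * Real.exp (-|c|) ≤ 3 * Real.exp (-(1 / 2) * |c|) := by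
    have he : Real.exp (-|c|) = Real.exp (-(|c| / 2)) * Real.exp (-(|c| / 2)) := by
      rw [← Real.exp_add]; congr 1; ring
    have he' : Real.exp (-(1 / 2) * |c|) = Real.exp (-(|c| / 2)) := by congr 1; ring
    rw [he, he']
    have hle : Real.exp (-(|c| / 2)) ≤ 1 := Real.exp_le_one_iff.2 (by
      have := abs_nonneg c; linarith)
    nlinarith [Real.exp_pos (-(|c| / 2)), abs_nonneg c]
  calc (1 + |c|) * ‖cosTailFull g c‖ ^ 2 ≤ (1 + |c|) * (K * Real.exp (-|c|)) :=
        mul_le_mul_of_nonneg_left (hK c) (by positivity)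
    _ = K * ((1 + |c|) * Real.exp (-|c|)) := by ring
    _ ≤ K * (3 * Real.exp (-(1 / 2) * |c|)) := mul_le_mul_of_nonneg_left h2 hK0
    _ = 3 * K * Real.exp (-(1 / 2) * |c|) := by ring

/-- `‖cosTailFull g‖²` is integrable. [cite: ConnesConsani2021, §1 Lemma 1.4 (i) eq. (16) p. 7] -/
theorem integrable_norm_sq_cosTailFull' (hg : IsWeilTest g) (hga : tsupport g ⊆ Set.Icc (-a) a) :
    Integrable fun c : ℝ => ‖cosTailFull g c‖ ^ 2 :=
  (integrable_norm_sq_cosTailFull hg.1.continuous hg.2 hga).1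


/-! ## 6. Tonelli on the triangle `{a < m ≤ c}` -/

/-- **The uncut fibers**: `∫_{m > a} (∫_{c ≥ m} ‖cosTailFull g c‖² dc) dm = ∫_{c > a} (c − a)‖cosTailFull g c‖² dc`
(Tonelli on `{a < m ≤ c}`), together with the integrability of the fiber function on `(a, ∞)`.
[cite: ConnesConsani2021, §2 Prop. 2.2 (iii) (= arXiv Prop. 10 (iii)) p. 10 (chunk p0010:L59–L75)] -/
theorem integral_Ioi_fiber_full (hg : IsWeilTest g) (hga : tsupport g ⊆ Set.Icc (-a) a) :
    IntegrableOn (fun m : ℝ => ∫ c in Set.Ici m, ‖cosTailFull g c‖ ^ 2) (Set.Ioi a) ∧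
    ∫ m in Set.Ioi a, ∫ c in Set.Ici m, ‖cosTailFull g c‖ ^ 2
      = ∫ c in Set.Ioi a, (c - a) * ‖cosTailFull g c‖ ^ 2 := by
  set w : ℝ → ℝ := fun c => ‖cosTailFull g c‖ ^ 2 with hw
  have hwc : Continuous w := (continuous_cosTailFull hg.1.continuous hg.2).norm.pow 2
  have hw0 : ∀ c, 0 ≤ w c := fun c => by positivity
  set S : Set (ℝ × ℝ) := {q | a < q.1 ∧ q.1 ≤ q.2} with hS_def
  have hS : MeasurableSet S :=
    (measurableSet_lt measurable_const measurable_fst).inter (measurableSet_le measurable_fst measurable_snd)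
  set F : ℝ × ℝ → ℝ := S.indicator (fun q => w q.2) with hF_def
  have hrow : ∀ c m, F (m, c) = (Set.Ioc a c).indicator (fun _ => w c) m := by
    intro c m
    simp only [hF_def, Set.indicator, hS_def, Set.mem_setOf_eq, Set.mem_Ioc]
  have hcol : ∀ m, (fun c => F (m, c)) = (Set.Ioi a).indicator
      (fun m => (Set.Ici m).indicator w) m := by
    intro m; funext c
    by_cases h1 : a < m <;> by_cases h2 : m ≤ c <;>
      simp [hF_def, hS_def, h1, h2]
  -- row integrals
  have hrow_int : ∀ c, Integrable (fun m => F (m, c)) (volume : Measure ℝ) := by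
    intro c
    rw [show (fun m => F (m, c)) = (Set.Ioc a c).indicator (fun _ => w c) from funext (hrow c)]
    exact (integrable_indicator_iff measurableSet_Ioc).2
      (integrableOn_const (by rw [Real.volume_Ioc]; exact ENNReal.ofReal_ne_top))
  have hrow_val : ∀ c, ∫ m, ‖F (m, c)‖ = max (c - a) 0 * w c := by
    intro c
    have h1 : (fun m => ‖F (m, c)‖) = (Set.Ioc a c).indicator (fun _ => w c) := by
      funext m
      rw [hrow c m, Real.norm_eq_abs]
      by_cases hm : m ∈ Set.Ioc a c
      · rw [Set.indicator_of_mem hm, abs_of_nonneg (hw0 c)]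
      · rw [Set.indicator_of_notMem hm, abs_zero]
    rw [h1, integral_indicator measurableSet_Ioc, setIntegral_const, Real.volume_real_Ioc, smul_eq_mul]
  have hrow_val' : ∀ c, ∫ m, F (m, c) = max (c - a) 0 * w c := by
    intro c
    rw [← hrow_val c]
    congr 1 with m
    rw [hrow c m, Real.norm_eq_abs]
    by_cases hm : m ∈ Set.Ioc a c
    · rw [Set.indicator_of_mem hm, abs_of_nonneg (hw0 c)]
    · rw [Set.indicator_of_notMem hm, abs_zero]
  -- integrability of `F` on the product
  have hFm : AEStronglyMeasurable F ((volume : Measure ℝ).prod volume) :=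
    ((hwc.measurable.comp measurable_snd).indicator hS).aestronglyMeasurable
  have hweight : Integrable (fun c => max (c - a) 0 * w c) (volume : Measure ℝ) := by
    have hI := (integrable_one_add_abs_mul_norm_sq_cosTailFull hg hga).const_mul (1 + |a|)
    refine hI.mono' ((continuous_id.sub continuous_const).max continuous_const |>.mul hwc).aestronglyMeasurable
      (Eventually.of_forall fun c => ?_)
    rw [Real.norm_eq_abs, abs_mul, abs_of_nonneg (le_max_right _ _), abs_of_nonneg (hw0 c)]
    have hmax : max (c - a) 0 ≤ (1 + |a|) * (1 + |c|) := by
      refine max_le ?_ (by positivity)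
      have h1 := le_abs_self c; have h2 := neg_abs_le a
      nlinarith [abs_nonneg a, abs_nonneg c]
    calc max (c - a) 0 * w c ≤ (1 + |a|) * (1 + |c|) * w c :=
          mul_le_mul_of_nonneg_right hmax (hw0 c)
      _ = (1 + |a|) * ((1 + |c|) * ‖cosTailFull g c‖ ^ 2) := by rw [hw]; ring
  have hFi : Integrable F ((volume : Measure ℝ).prod volume) := by
    rw [integrable_prod_iff' hFm]
    refine ⟨Eventually.of_forall hrow_int, ?_⟩
    exact hweight.congr (Eventually.of_forall fun c => (hrow_val c).symm)
  -- the fiber function is `m ↦ ∫ c, F (m, c)`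
  have hfib : ∀ m, ∫ c, F (m, c) = (Set.Ioi a).indicator (fun m => ∫ c in Set.Ici m, w c) m := by
    intro m
    rw [hcol m]
    by_cases hm : m ∈ Set.Ioi a
    · rw [Set.indicator_of_mem hm, Set.indicator_of_mem hm, integral_indicator measurableSet_Ici]
    · rw [Set.indicator_of_notMem hm, Set.indicator_of_notMem hm]; simp
  refine ⟨?_, ?_⟩
  · have h := hFi.integral_prod_left
    rw [show (fun m => ∫ c, F (m, c)) = (Set.Ioi a).indicator (fun m => ∫ c in Set.Ici m, w c)
      from funext hfib] at h
    exact (integrable_indicator_iff measurableSet_Ioi).1 h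
  · calc ∫ m in Set.Ioi a, ∫ c in Set.Ici m, w c
        = ∫ m, (Set.Ioi a).indicator (fun m => ∫ c in Set.Ici m, w c) m :=
          (integral_indicator measurableSet_Ioi).symm
      _ = ∫ m, ∫ c, F (m, c) := integral_congr_ae (Eventually.of_forall fun m => (hfib m).symm)
      _ = ∫ c, ∫ m, F (m, c) :=
          integral_integral_swap (hFi.congr (Eventually.of_forall fun p => by obtain ⟨m, c⟩ := p; rfl))
      _ = ∫ c, max (c - a) 0 * w c := integral_congr_ae (Eventually.of_forall hrow_val')
      _ = ∫ c, (Set.Ioi a).indicator (fun c => (c - a) * w c) c := by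
          congr 1 with c
          by_cases hc : c ∈ Set.Ioi a
          · rw [Set.indicator_of_mem hc, max_eq_left (by simp only [Set.mem_Ioi] at hc; linarith)]
          · rw [Set.indicator_of_notMem hc, max_eq_right (by simp only [Set.mem_Ioi, not_lt] at hc; linarith),
              zero_mul]
      _ = ∫ c in Set.Ioi a, (c - a) * w c := integral_indicator measurableSet_Ioi

/-! ## 7. Tonelli on the box `m ∈ [−a, a]`, `σ ≥ −m` -/

/-- **The cut mass over the box**: `∫_{m ∈ [−a,a]} (∫_{σ ≥ −m} ‖g σ‖² dσ) dm = ∫ (a + σ)‖g σ‖² dσ` when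
`supp g ⊆ [−a, a]` (for `σ` in the support the admissible `m` form `[−σ, a]`), with the integrability of
the inner function on the box. [cite: ConnesConsani2021, §2 Prop. 2.2 (iii) (= arXiv Prop. 10 (iii)) p. 10 (chunk p0010:L59–L75)] -/
theorem integral_Icc_cut_mass (hg : IsWeilTest g) (hga : tsupport g ⊆ Set.Icc (-a) a) :
    IntegrableOn (fun m : ℝ => ∫ σ in Set.Ici (-m), ‖g σ‖ ^ 2) (Set.Icc (-a) a) ∧
    ∫ m in Set.Icc (-a) a, ∫ σ in Set.Ici (-m), ‖g σ‖ ^ 2 = ∫ σ, (a + σ) * ‖g σ‖ ^ 2 := by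
  set w : ℝ → ℝ := fun σ => ‖g σ‖ ^ 2 with hw
  have hwc : Continuous w := hg.1.continuous.norm.pow 2
  have hw0 : ∀ σ, 0 ≤ w σ := fun σ => by positivity
  have hwz : ∀ σ, σ ∉ Set.Icc (-a) a → w σ = 0 := fun σ hσ => by
    simp [hw, image_eq_zero_of_notMem_tsupport fun h => hσ (hga h)]
  set S : Set (ℝ × ℝ) := {q | q.1 ∈ Set.Icc (-a) a ∧ -q.1 ≤ q.2} with hS_def
  have hS : MeasurableSet S :=
    (measurableSet_Icc.preimage measurable_fst).inter (measurableSet_le measurable_fst.neg measurable_snd)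
  set F : ℝ × ℝ → ℝ := S.indicator (fun q => w q.2) with hF_def
  have hrow : ∀ σ m, F (m, σ) = (Set.Icc (max (-a) (-σ)) a).indicator (fun _ => w σ) m := by
    intro σ m
    have e : (-σ ≤ m) ↔ (-m ≤ σ) := neg_le
    by_cases h1 : -a ≤ m <;> by_cases h2 : m ≤ a <;> by_cases h3 : -m ≤ σ <;>
      simp [hF_def, hS_def, Set.mem_Icc, e, h1, h2, h3]
  have hcol : ∀ m, (fun σ => F (m, σ)) = (Set.Icc (-a) a).indicator
      (fun m => (Set.Ici (-m)).indicator w) m := by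
    intro m; funext σ
    by_cases h1 : -a ≤ m <;> by_cases h1' : m ≤ a <;> by_cases h2 : -m ≤ σ <;>
      simp [hF_def, hS_def, Set.mem_Icc, h1, h1', h2]
  have hrow_int : ∀ σ, Integrable (fun m => F (m, σ)) (volume : Measure ℝ) := by
    intro σ
    rw [show (fun m => F (m, σ)) = (Set.Icc (max (-a) (-σ)) a).indicator (fun _ => w σ) from funext (hrow σ)]
    exact (integrable_indicator_iff measurableSet_Icc).2
      (integrableOn_const (by rw [Real.volume_Icc]; exact ENNReal.ofReal_ne_top))
  have hrow_val : ∀ σ, ∫ m, ‖F (m, σ)‖ = (a + σ) * w σ := by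
    intro σ
    have h1 : (fun m => ‖F (m, σ)‖) = (Set.Icc (max (-a) (-σ)) a).indicator (fun _ => w σ) := by
      funext m
      rw [hrow σ m, Real.norm_eq_abs]
      by_cases hm : m ∈ Set.Icc (max (-a) (-σ)) a
      · rw [Set.indicator_of_mem hm, abs_of_nonneg (hw0 σ)]
      · rw [Set.indicator_of_notMem hm, abs_zero]
    rw [h1, integral_indicator measurableSet_Icc, setIntegral_const, Real.volume_real_Icc, smul_eq_mul]
    by_cases hσ : σ ∈ Set.Icc (-a) a
    · simp only [Set.mem_Icc] at hσ
      rw [max_eq_right (show -a ≤ -σ by linarith), max_eq_left (show (0:ℝ) ≤ a - -σ by linarith)]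
      ring
    · rw [hwz σ hσ, mul_zero, mul_zero]
  have hrow_val' : ∀ σ, ∫ m, F (m, σ) = (a + σ) * w σ := by
    intro σ
    rw [← hrow_val σ]
    congr 1 with m
    rw [hrow σ m, Real.norm_eq_abs]
    by_cases hm : m ∈ Set.Icc (max (-a) (-σ)) a
    · rw [Set.indicator_of_mem hm, abs_of_nonneg (hw0 σ)]
    · rw [Set.indicator_of_notMem hm, abs_zero]
  have hFm : AEStronglyMeasurable F ((volume : Measure ℝ).prod volume) :=
    ((hwc.measurable.comp measurable_snd).indicator hS).aestronglyMeasurable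
  have hweight : Integrable (fun σ => (a + σ) * w σ) (volume : Measure ℝ) := by
    have h1 : HasCompactSupport (fun σ : ℝ => ((a + σ) * ‖g σ‖) * ‖g σ‖) := hg.2.norm.mul_left
    have h2 : Continuous (fun σ : ℝ => ((a + σ) * ‖g σ‖) * ‖g σ‖) := by
      have := hg.1.continuous.norm; fun_prop
    exact (h2.integrable_of_hasCompactSupport h1).congr (Eventually.of_forall fun σ => by
      simp only [hw]; ring)
  have hFi : Integrable F ((volume : Measure ℝ).prod volume) := by
    rw [integrable_prod_iff' hFm]
    refine ⟨Eventually.of_forall hrow_int, ?_⟩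
    exact hweight.congr (Eventually.of_forall fun σ => (hrow_val σ).symm)
  have hfib : ∀ m, ∫ σ, F (m, σ) = (Set.Icc (-a) a).indicator (fun m => ∫ σ in Set.Ici (-m), w σ) m := by
    intro m
    rw [hcol m]
    by_cases hm : m ∈ Set.Icc (-a) a
    · rw [Set.indicator_of_mem hm, Set.indicator_of_mem hm, integral_indicator measurableSet_Ici]
    · rw [Set.indicator_of_notMem hm, Set.indicator_of_notMem hm]; simp
  refine ⟨?_, ?_⟩
  · have h := hFi.integral_prod_left
    rw [show (fun m => ∫ σ, F (m, σ)) = (Set.Icc (-a) a).indicator (fun m => ∫ σ in Set.Ici (-m), w σ)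
      from funext hfib] at h
    exact (integrable_indicator_iff measurableSet_Icc).1 h
  · calc ∫ m in Set.Icc (-a) a, ∫ σ in Set.Ici (-m), w σ
        = ∫ m, (Set.Icc (-a) a).indicator (fun m => ∫ σ in Set.Ici (-m), w σ) m :=
          (integral_indicator measurableSet_Icc).symm
      _ = ∫ m, ∫ σ, F (m, σ) := integral_congr_ae (Eventually.of_forall fun m => (hfib m).symm)
      _ = ∫ σ, ∫ m, F (m, σ) :=
          integral_integral_swap (hFi.congr (Eventually.of_forall fun p => by obtain ⟨m, σ⟩ := p; rfl))
      _ = ∫ σ, (a + σ) * w σ := integral_congr_ae (Eventually.of_forall hrow_val')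


/-! ## 8. The frame, and the assembly of (T2) from the two analytic halves -/

/-- **THE FRAME of Prop. 2.2 (iii)** (exact and finite).  If `supp g ⊆ [−a, a]` then
`4∫_{[0,∞)×ℝ} ‖cosTail g s c‖² = [∫ σ‖g σ‖² dσ + 4∫ c‖cosTailFull g c‖² dc]
 + [4∫_{c ≤ a}(a − c)‖cosTailFull g c‖² dc − 4∫_{m ∈ [−a,a]}∫_{c ≤ m}‖cosTail g (c − m) c‖² dc dm]`.
The first bracket is the `W_∞`-half (by the log-moment identity of `CosineTailLogMoment` it equals
`Re W_∞(g ∗ g*)`, Prop. 1.5 (iii) through `θ′`), the second the square-`Δ` half (`= Re D(g ∗ g*)` by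
Prop. 2.2 (i), `CosineTailDeltaSquare`).  The parentheses around the set integrals are load-bearing (the
`∫ x in s, ·` binder has precedence 60). [cite: ConnesConsani2021, §2 Prop. 2.2 (iii) (= arXiv Prop. 10 (iii)) proof p. 10 (chunk p0010:L59–L75); §1 Prop. 1.5 (iii) (arXiv: Prop. 8 (iii)) p. 8] -/
theorem cosTail_energy_frame (hg : IsWeilTest g) (hga : tsupport g ⊆ Set.Icc (-a) a) :
    4 * ∫ p, ‖cosTail g p.1 p.2‖ ^ 2 ∂(((volume : Measure ℝ).restrict (Set.Ici 0)).prod (volume : Measure ℝ))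
      = ((∫ σ : ℝ, σ * ‖g σ‖ ^ 2) + 4 * ∫ c : ℝ, c * ‖cosTailFull g c‖ ^ 2)
        + (4 * (∫ c in Set.Iic a, (a - c) * ‖cosTailFull g c‖ ^ 2)
          - 4 * (∫ m in Set.Icc (-a) a, ∫ c in Set.Iic m, ‖cosTail g (c - m) c‖ ^ 2)) := by
  have hgc : Continuous g := hg.1.continuous
  -- the fiber function and its pieces
  set f : ℝ → ℝ := fun m => ∫ c in Set.Ici m, ‖cosTail g (c - m) c‖ ^ 2 with hf
  have hf_int : Integrable f := integrable_fiber_energy hg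
  have hQ : ∫ p, ‖cosTail g p.1 p.2‖ ^ 2 ∂(((volume : Measure ℝ).restrict (Set.Ici 0)).prod
      (volume : Measure ℝ)) = ∫ m, f m := (cosTail_energy_eq_integral_fiber hg).2
  have hf_zero : ∀ m, m < -a → f m = 0 := fun m hm => fiber_eq_zero hga hm
  have hf_full : ∀ m, a < m → f m = ∫ c in Set.Ici m, ‖cosTailFull g c‖ ^ 2 := fun m hm =>
    setIntegral_congr_fun measurableSet_Ici fun c _ => by rw [cosTail_sub_eq_cosTailFull hga hm.le]
  -- `∫ f = ∫_{[−a,a]} f + ∫_{(a,∞)} f`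
  have hsplit : ∫ m, f m = (∫ m in Set.Icc (-a) a, f m) + ∫ m in Set.Ioi a, f m := by
    have h1 := integral_add_compl (measurableSet_Iic (a := a)) hf_int
    rw [compl_Iic] at h1
    have h2 : ∫ m in Set.Iic a, f m = ∫ m in Set.Icc (-a) a, f m := by
      rw [← integral_indicator measurableSet_Iic, ← integral_indicator measurableSet_Icc]
      congr 1 with m
      by_cases h3 : m < -a
      · have hz : f m = 0 := hf_zero m h3
        by_cases h4 : m ≤ a <;> simp [Set.mem_Icc, h3, h4, hz]
      · by_cases h4 : m ≤ a <;> simp [Set.mem_Icc, not_lt.1 h3, h4]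
    rw [← h1, h2]
  -- the part above the support
  have hIoi : ∫ m in Set.Ioi a, f m = ∫ c in Set.Ioi a, (c - a) * ‖cosTailFull g c‖ ^ 2 := by
    rw [setIntegral_congr_fun measurableSet_Ioi (fun m hm => hf_full m hm)]
    exact (integral_Ioi_fiber_full hg hga).2
  -- the box: `f m = ¼∫_{σ ≥ −m}‖g‖² − ∫_{c ≤ m}‖cosTail g (c−m) c‖²`
  have hS : ∀ m, f m = (1 / 4) * (∫ σ in Set.Ici (-m), ‖g σ‖ ^ 2)
      - ∫ c in Set.Iic m, ‖cosTail g (c - m) c‖ ^ 2 := by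
    intro m
    obtain ⟨hint_m, hval_m⟩ := integrable_norm_sq_cosTail_sub hgc hg.2 m
    have hc := integral_add_compl (measurableSet_Ici (a := m)) hint_m
    rw [compl_Ici, ← integral_Iic_eq_integral_Iio, hval_m] at hc
    rw [hf]; simp only
    linarith
  obtain ⟨hcut_int, hcut_val⟩ := integral_Icc_cut_mass hg hga
  have hbox_int : IntegrableOn (fun m => ∫ c in Set.Iic m, ‖cosTail g (c - m) c‖ ^ 2) (Set.Icc (-a) a) := by
    have h : IntegrableOn (fun m => (1 / 4) * (∫ σ in Set.Ici (-m), ‖g σ‖ ^ 2) - f m) (Set.Icc (-a) a) :=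
      (hcut_int.const_mul (1 / 4)).sub hf_int.integrableOn
    refine IntegrableOn.congr_fun h (fun m _ => ?_) measurableSet_Icc
    rw [hS m]
    ring
  have hIcc : ∫ m in Set.Icc (-a) a, f m = (1 / 4) * (∫ σ, (a + σ) * ‖g σ‖ ^ 2)
      - ∫ m in Set.Icc (-a) a, ∫ c in Set.Iic m, ‖cosTail g (c - m) c‖ ^ 2 := by
    rw [setIntegral_congr_fun measurableSet_Icc (fun m _ => hS m), integral_sub (hcut_int.const_mul _) hbox_int,
      integral_const_mul, hcut_val]
  -- the full transform: Plancherel and the split at `c = a`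
  set W : ℝ → ℝ := fun c => ‖cosTailFull g c‖ ^ 2 with hW
  have hW_int : Integrable W := integrable_norm_sq_cosTailFull' hg hga
  have hcW_int : Integrable fun c => c * W c := integrable_mul_norm_sq_cosTailFull hg
  have hP : ∫ c, W c = (1 / 4) * ∫ σ, ‖g σ‖ ^ 2 := (integrable_norm_sq_cosTailFull hgc hg.2 hga).2
  have hA := integral_add_compl (measurableSet_Iic (a := a)) hcW_int
  have hB := integral_add_compl (measurableSet_Iic (a := a)) hW_int
  rw [compl_Iic] at hA hB
  have hC : ∫ c in Set.Ioi a, (c - a) * W c = (∫ c in Set.Ioi a, c * W c) - a * ∫ c in Set.Ioi a, W c := by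
    rw [← integral_const_mul, ← integral_sub hcW_int.integrableOn (hW_int.integrableOn.const_mul a)]
    refine setIntegral_congr_fun measurableSet_Ioi fun c _ => ?_
    ring
  have hD : ∫ c in Set.Iic a, (a - c) * W c = a * (∫ c in Set.Iic a, W c) - ∫ c in Set.Iic a, c * W c := by
    rw [← integral_const_mul, ← integral_sub (hW_int.integrableOn.const_mul a) hcW_int.integrableOn]
    refine setIntegral_congr_fun measurableSet_Iic fun c _ => ?_
    ring
  -- `∫ (a + σ)‖g‖² = a∫‖g‖² + ∫ σ‖g‖²`
  have hg2_int : Integrable fun σ : ℝ => ‖g σ‖ ^ 2 := by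
    have h1 : HasCompactSupport (fun σ : ℝ => ‖g σ‖ * ‖g σ‖) := hg.2.norm.mul_left
    exact ((hgc.norm.mul hgc.norm).integrable_of_hasCompactSupport h1).congr
      (Eventually.of_forall fun σ => by simp only [Pi.mul_apply]; ring)
  have hσg2_int : Integrable fun σ : ℝ => σ * ‖g σ‖ ^ 2 := by
    have h1 : HasCompactSupport (fun σ : ℝ => (σ * ‖g σ‖) * ‖g σ‖) := hg.2.norm.mul_left
    have h2 : Continuous (fun σ : ℝ => (σ * ‖g σ‖) * ‖g σ‖) := by
      have := hgc.norm; fun_prop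
    exact (h2.integrable_of_hasCompactSupport h1).congr (Eventually.of_forall fun σ => by
      simp only; ring)
  have hE : ∫ σ, (a + σ) * ‖g σ‖ ^ 2 = a * (∫ σ, ‖g σ‖ ^ 2) + ∫ σ, σ * ‖g σ‖ ^ 2 := by
    rw [← integral_const_mul, ← integral_add (hg2_int.const_mul a) hσg2_int]
    congr 1 with σ
    ring
  have hAB : a * (∫ c in Set.Iic a, W c) + a * (∫ c in Set.Ioi a, W c) = a * ((1 / 4) * ∫ σ, ‖g σ‖ ^ 2) := by
    rw [← mul_add, hB, hP]
  -- assemble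
  rw [hQ, hsplit, hIcc, hIoi, hC, hD, hE]
  linarith [hA, hAB]

/-- **(T2) from the two analytic halves.**  Given the log-moment identity (`W_∞`-half, Prop. 1.5 (iii):
`4∫ c‖cosTailFull g c‖² dc = Re W_∞(g ∗ g*) − ∫σ‖g‖²`, proved in `CosineTailLogMoment.lean`) and the
square-`Δ` identity (`D`-half, Prop. 2.2 (i): `4∫_{c≤a}(a−c)‖cosTailFull‖² − 4∫_{[−a,a]}∫_{c≤m}
‖cosTail g (c−m) c‖² = Re D(g ∗ g*)`, proved in `CosineTailDeltaSquare.lean`) — taken here as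
hypotheses, i.e. as the STATEMENTS of those theorems — the frame gives the cosine-tail energy identity
`4∫_{[0,∞)×ℝ}‖cosTail g‖² = Re L(g ∗ g*)`, `L = traceL = W_∞ + D` = the content of Prop. 2.2 (iii).
[cite: ConnesConsani2021, §2 Prop. 2.2 (iii) (= arXiv Prop. 10 (iii)) p. 10 (chunk p0010:L20, L59–L75)] -/
theorem cosTail_energy_of_logMoment_of_deltaSquare (hg : IsWeilTest g)
    (H1 : 4 * ∫ c : ℝ, c * ‖cosTailFull g c‖ ^ 2
        = (archW (weilConv g (weilReflect g))).re - ∫ σ : ℝ, σ * ‖g σ‖ ^ 2)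
    (H2 : ∀ a : ℝ, tsupport g ⊆ Set.Icc (-a) a →
        4 * (∫ c in Set.Iic a, (a - c) * ‖cosTailFull g c‖ ^ 2)
          - 4 * (∫ m in Set.Icc (-a) a, ∫ c in Set.Iic m, ‖cosTail g (c - m) c‖ ^ 2)
        = (remainderD (weilConv g (weilReflect g))).re) :
    4 * ∫ p, ‖cosTail g p.1 p.2‖ ^ 2 ∂(((volume : Measure ℝ).restrict (Set.Ici 0)).prod (volume : Measure ℝ))
      = (traceL (weilConv g (weilReflect g))).re := by
  obtain ⟨a, -, hga⟩ := exists_tsupport_subset_Icc hg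
  rw [cosTail_energy_frame hg hga, H2 a hga, traceL, Complex.add_re, H1]
  ring

/-- The iterated form of the previous assembly: `4∫_{s ≥ 0}(∫_ℝ ‖cosTail g s c‖² dc) ds = Re L(g ∗ g*)`.
[cite: ConnesConsani2021, §2 Prop. 2.2 (iii) (= arXiv Prop. 10 (iii)) p. 10 (chunk p0010:L20)] -/
theorem cosTail_energy_of_logMoment_of_deltaSquare' (hg : IsWeilTest g)
    (H1 : 4 * ∫ c : ℝ, c * ‖cosTailFull g c‖ ^ 2
        = (archW (weilConv g (weilReflect g))).re - ∫ σ : ℝ, σ * ‖g σ‖ ^ 2)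
    (H2 : ∀ a : ℝ, tsupport g ⊆ Set.Icc (-a) a →
        4 * (∫ c in Set.Iic a, (a - c) * ‖cosTailFull g c‖ ^ 2)
          - 4 * (∫ m in Set.Icc (-a) a, ∫ c in Set.Iic m, ‖cosTail g (c - m) c‖ ^ 2)
        = (remainderD (weilConv g (weilReflect g))).re) :
    4 * ∫ s in Set.Ici (0 : ℝ), ∫ c, ‖cosTail g s c‖ ^ 2 = (traceL (weilConv g (weilReflect g))).re := by
  rw [← cosTail_energy_of_logMoment_of_deltaSquare hg H1 H2, integral_prod _ (integrable_cosTail_normSq hg)]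


/-! ## 9. (T2) unconditionally, and the discharge of `CC2021_prop_2_2_iii` -/

/-- **(T2), the cosine-tail energy identity** `4∫_{[0,∞)×ℝ} ‖cosTail g s c‖² d(s,c) = Re L(g ∗ g*)`
(`L = traceL = W_∞ + D`), unconditionally: the frame `cosTail_energy_frame` fed with the two analytic
halves proved by the cell — the log-moment identity `cosTailFull_logMoment` (`CosineTailLogMoment.lean`,
the `W_∞`-half, Prop. 1.5 (iii)) and the square-`Δ` identity `cosTail_deltaSquare`
(`CosineTailDeltaSquare.lean`, the `D`-half, Prop. 2.2 (i)–(ii)).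
[cite: ConnesConsani2021, §2 Prop. 2.2 (iii) (= arXiv Prop. 10 (iii)) p. 10 (chunk p0010:L20, L59–L75)] -/
theorem cosTail_energy (hg : IsWeilTest g) :
    4 * ∫ p, ‖cosTail g p.1 p.2‖ ^ 2 ∂(((volume : Measure ℝ).restrict (Set.Ici 0)).prod (volume : Measure ℝ))
      = (traceL (weilConv g (weilReflect g))).re :=
  cosTail_energy_of_logMoment_of_deltaSquare hg (cosTailFull_logMoment hg)
    (fun _ hga => cosTail_deltaSquare hg hga)

/-- (T2) in iterated form: `4∫_{s ≥ 0}(∫_ℝ ‖cosTail g s c‖² dc) ds = Re L(g ∗ g*)`.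
[cite: ConnesConsani2021, §2 Prop. 2.2 (iii) (= arXiv Prop. 10 (iii)) p. 10 (chunk p0010:L20)] -/
theorem cosTail_energy' (hg : IsWeilTest g) :
    4 * ∫ s in Set.Ici (0 : ℝ), ∫ c, ‖cosTail g s c‖ ^ 2 = (traceL (weilConv g (weilReflect g))).re :=
  cosTail_energy_of_logMoment_of_deltaSquare' hg (cosTailFull_logMoment hg)
    (fun _ hga => cosTail_deltaSquare hg hga)

/-- **Prop. 2.2 (iii) DISCHARGED**: `Tr(ϑ(f) P P̂ P) = ∫ f(ρ⁻¹)(δ(ρ) − τ(ρ)) d*ρ` in the tree's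
Hilbert–Schmidt form `CC2021_prop_2_2_iii` (`SchwartzKernels.lean`), through the cell's reduction
`CC2021_prop_2_2_iii_of_cosTail_energy` (`CutoffScalingKernelEnergy.lean`: kernel of `ϑ(g)P_Λ𝐏̂_Λ`,
its Hilbert–Schmidt energy as the cosine-tail energy) applied to (T1) `integrable_cosTail_normSq` and
(T2) `cosTail_energy`. [cite: ConnesConsani2021, §2 Prop. 2.2 (iii) (= arXiv Prop. 10 (iii)) p. 10] -/
theorem CC2021_prop_2_2_iii_holds : CC2021_prop_2_2_iii :=
  CC2021_prop_2_2_iii_of_cosTail_energy (fun _ hg => integrable_cosTail_normSq hg)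
    (fun _ hg => cosTail_energy hg)

end Literature.NumberTheory.ConnesConsani2021

end
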